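import Summits.QuantumAdvantage.AdviceFreeQNC0.WalkTubeWalk
import Summits.QuantumAdvantage.AdviceFreeQNC0.WalkSupportLemma
import HarnessLib

/-!
# Cell qa-qnc0 (rung F-Q1, route `RingFrame`, crux α `RingToElim`): THE TUBE BOUND — T11-4
# `TubeMass` (qn-p2 ROUND-11, ask P11-B, part 2: the assembly B4)

PROVED: **`tubeMass : TubeMass`** with `C = 6`, `m₀ = 256` — the far tube `FAR_{m/2 − 6⌊√m⌋}`
(patterns whose distance walk `d_g(a) = pdist a (aPat g)` stays in the open band `(k, m−k)` at every
cut, together with the conjugate; `farSet` of `WalkTube.lean`) holds at least half of `{0,1}^m`.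
B4 over `WalkTubeWalk.lean`: `card_bad_le` — `{a ∉ FAR_k} ⊆ LOW ∪ conj⁻¹LOW` (`lowEv_of_nearPath`,
`lowEv_conj_of_nearPath_conj`: near the path means `2S_g − S_m ≤ −W`, `W = m − 2k`), `LOW ⊆
{walk dips to −L} ∪ {S_m ≥ L}` for `3L ≤ W` (`low_cases`), reflection + Chebyshev ⇒
`#BAD ≤ 6·#{L ≤ |S_m|} ≤ 6m·2^m/L²`; with `L = ⌊W/3⌋ ≥ 4⌊√m⌋`, `L² ≥ 12m` this is `≤ 2^m/2`.

WHAT THIS IS NOT: nothing on α by itself (the plan is `WalkTubeRank.tubePlan`); separation NOT moved by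
this file alone.
-/

noncomputable section

open Classical

namespace Summit.QuantumAdvantage.AdviceFreeQNC0

open Finset
open Literature.Computability.MetaComplexity Literature.Computability.MetaComplexity.Smolensky
open F4

namespace TubeMassProof

variable {m : ℕ}

/-! ### B4: assembly -/

/-- Counting through conjugation. -/
theorem card_filter_conj (P : (Fin m → Bool) → Prop) :
    (univ.filter fun a : Fin m → Bool => P (conj a)).card = (univ.filter P).card := by
  refine card_bij (fun a _ => conj a) (fun a ha => ?_) (fun a _ b _ h => ?_) (fun b hb => ?_)
  · rw [mem_filter] at ha ⊢; exact ⟨mem_univ _, ha.2⟩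
  · have := congrArg conj h; rwa [conj_conj, conj_conj] at this
  · refine ⟨conj b, ?_, conj_conj b⟩
    rw [mem_filter] at hb ⊢; exact ⟨mem_univ _, by rw [conj_conj]; exact hb.2⟩

/-- the LOW event: at some cut `2S_g − S_m ≤ −W`. -/
def LowEv (W : ℕ) (a : Fin m → Bool) : Prop := ∃ g : ℕ, g ≤ m ∧ 2 * S a g - S a m ≤ -(W : ℤ)

/-- Near the path ⇒ LOW (with `W = m − 2k`). -/
theorem lowEv_of_nearPath {k : ℕ} (hk : 2 * k ≤ m) {a : Fin m → Bool} (h : NearPath k a) :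
    LowEv (m - 2 * k) a := by
  obtain ⟨g, hgm, hg⟩ := (nearPath_iff k a).1 h
  refine ⟨g, hgm, ?_⟩
  have h1 := pdist_aPat_eq a g
  have h2 := two_wtP_add_S a
  have h3 : (pdist a (aPat g) : ℤ) ≤ k := by exact_mod_cast hg
  have h4 : ((m - 2 * k : ℕ) : ℤ) = (m : ℤ) - 2 * k := by
    rw [Nat.cast_sub hk]; push_cast; ring
  rw [h4]
  linarith

/-- Conjugate near the path ⇒ conjugate-LOW. -/
theorem lowEv_conj_of_nearPath_conj {k : ℕ} (hk : 2 * k ≤ m) {a : Fin m → Bool}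
    (h : NearPath k (conj a)) : LowEv (m - 2 * k) (conj a) := by
  obtain ⟨g, hgm, hg⟩ := (nearPath_iff k (conj a)).1 h
  refine ⟨g, hgm, ?_⟩
  rw [S_conj, S_conj]
  have h0 := pdist_conj_aPat a g
  have h1 := pdist_aPat_eq a g
  have h2 := two_wtP_add_S a
  have h3 : (pdist (conj a) (aPat g) : ℤ) + pdist a (aPat g) = m := by exact_mod_cast h0
  have h3' : (pdist (conj a) (aPat g) : ℤ) ≤ k := by exact_mod_cast hg
  have h4 : ((m - 2 * k : ℕ) : ℤ) = (m : ℤ) - 2 * k := by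
    rw [Nat.cast_sub hk]; push_cast; ring
  rw [h4]
  linarith

/-- LOW ⇒ the walk dips to `−L` at some cut, or ends at `≥ L` (`3L ≤ W`). -/
theorem low_cases {W L : ℕ} (hL : 3 * L ≤ W) {a : Fin m → Bool} (h : LowEv W a) :
    Hits (L : ℤ) (conj a) ∨ (L : ℤ) ≤ S a m := by
  obtain ⟨g, hgm, hg⟩ := h
  by_contra hc
  rw [not_or] at hc
  have h1 : ¬ (L : ℤ) ≤ S (conj a) g := fun hh => hc.1 ⟨g, hgm, hh⟩
  rw [S_conj] at h1
  have h2 := hc.2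
  have h3 : (3 * L : ℕ) ≤ (W : ℤ) := by exact_mod_cast hL
  push_cast at h3
  push Not at h1 h2
  linarith

/-- **Counting the bad set**: with `W = m − 2k`, `3L ≤ W`:
`#{a ∉ FAR_k} ≤ 6 · #{a : L ≤ |S_m(a)|}`. -/
theorem card_bad_le {k L : ℕ} (hk : 2 * k ≤ m) (hL : 3 * L ≤ m - 2 * k) :
    (univ.filter fun a : Fin m → Bool => NearPath k a ∨ NearPath k (conj a)).card ≤
      6 * (univ.filter fun a : Fin m → Bool => (L : ℤ) ≤ |S a m|).card := by
  set W := m - 2 * k with hW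
  set Q := (univ.filter fun a : Fin m → Bool => (L : ℤ) ≤ |S a m|).card with hQ
  -- the LOW set is small
  have hlow : (univ.filter fun a : Fin m → Bool => LowEv W a).card ≤ 3 * Q := by
    have hsub : (univ.filter fun a : Fin m → Bool => LowEv W a) ⊆
        (univ.filter fun a : Fin m → Bool => Hits (L : ℤ) (conj a)) ∪
          (univ.filter fun a : Fin m → Bool => (L : ℤ) ≤ S a m) := by
      intro a ha
      rw [mem_filter] at ha
      rw [mem_union, mem_filter, mem_filter]
      rcases low_cases hL ha.2 with h | h
      · exact Or.inl ⟨mem_univ _, h⟩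
      · exact Or.inr ⟨mem_univ _, h⟩
    have h1 : (univ.filter fun a : Fin m → Bool => Hits (L : ℤ) (conj a)).card ≤ 2 * Q := by
      rw [card_filter_conj (fun a => Hits (L : ℤ) a)]
      refine le_trans (reflection_count (L : ℤ)) (Nat.mul_le_mul_left _ (card_le_card fun a ha => ?_))
      rw [mem_filter] at ha ⊢
      exact ⟨mem_univ _, le_trans ha.2 (le_abs_self _)⟩
    have h2 : (univ.filter fun a : Fin m → Bool => (L : ℤ) ≤ S a m).card ≤ Q :=
      card_le_card fun a ha => by
        rw [mem_filter] at ha ⊢; exact ⟨mem_univ _, le_trans ha.2 (le_abs_self _)⟩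
    calc (univ.filter fun a : Fin m → Bool => LowEv W a).card
        ≤ ((univ.filter fun a : Fin m → Bool => Hits (L : ℤ) (conj a)) ∪
            (univ.filter fun a : Fin m → Bool => (L : ℤ) ≤ S a m)).card := card_le_card hsub
      _ ≤ _ := card_union_le _ _
      _ ≤ 2 * Q + Q := Nat.add_le_add h1 h2
      _ = 3 * Q := by ring
  -- BAD ⊆ LOW ∪ conj⁻¹ LOW
  have hsub : (univ.filter fun a : Fin m → Bool => NearPath k a ∨ NearPath k (conj a)) ⊆
      (univ.filter fun a : Fin m → Bool => LowEv W a) ∪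
        (univ.filter fun a : Fin m → Bool => LowEv W (conj a)) := by
    intro a ha
    rw [mem_filter] at ha
    rw [mem_union, mem_filter, mem_filter]
    rcases ha.2 with h | h
    · exact Or.inl ⟨mem_univ _, lowEv_of_nearPath hk h⟩
    · exact Or.inr ⟨mem_univ _, lowEv_conj_of_nearPath_conj hk h⟩
  calc (univ.filter fun a : Fin m → Bool => NearPath k a ∨ NearPath k (conj a)).card
      ≤ ((univ.filter fun a : Fin m → Bool => LowEv W a) ∪
          (univ.filter fun a : Fin m → Bool => LowEv W (conj a))).card := card_le_card hsub
    _ ≤ (univ.filter fun a : Fin m → Bool => LowEv W a).card +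
          (univ.filter fun a : Fin m → Bool => LowEv W (conj a)).card := card_union_le _ _
    _ = 2 * (univ.filter fun a : Fin m → Bool => LowEv W a).card := by
        rw [card_filter_conj (fun a => LowEv W a)]; ring
    _ ≤ 2 * (3 * Q) := Nat.mul_le_mul_left _ hlow
    _ = 6 * Q := by ring

/-- The far tube is the complement of the bad set. -/
theorem card_farSet_add (m k : ℕ) :
    (farSet m k).card +
      (univ.filter fun a : Fin m → Bool => NearPath k a ∨ NearPath k (conj a)).card = 2 ^ m := by
  have e : farSet m k = univ.filter fun a : Fin m → Bool => ¬ (NearPath k a ∨ NearPath k (conj a)) := by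
    unfold farSet
    exact filter_congr fun a _ => by rw [not_or]
  rw [e, add_comm, card_filter_add_card_filter_not, card_univ, Fintype.card_fun, Fintype.card_bool,
    Fintype.card_fin]

/-- **T11-4 `TubeMass` with `C = 6`, `m₀ = 256`**: the tube `FAR_{m/2 − 6⌊√m⌋}` holds at least
half of all patterns. -/
theorem tubeMass_six : ∃ C m₀ : ℕ, ∀ m ≥ m₀, 2 ^ m ≤ 2 * (farSet m (m / 2 - C * Nat.sqrt m)).card := by
  refine ⟨6, 256, fun m hm => ?_⟩
  set s := Nat.sqrt m with hs
  have hs16 : 16 ≤ s := by rw [hs, Nat.le_sqrt]; omega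
  have hss : s * s ≤ m := Nat.sqrt_le m
  have hlt : m < (s + 1) * (s + 1) := Nat.lt_succ_sqrt m
  set k := m / 2 - 6 * s with hk
  have h6s : 12 * s ≤ m := by nlinarith
  have hk2 : 2 * k ≤ m := by omega
  have hW : 12 * s ≤ m - 2 * k := by omega
  set L := (m - 2 * k) / 3 with hL
  have hL3 : 3 * L ≤ m - 2 * k := by rw [hL]; omega
  have hL4 : 4 * s ≤ L := by rw [hL]; omega
  have hLm : 12 * m ≤ L ^ 2 := by nlinarith
  have hbad := card_bad_le hk2 hL3
  have hcheb := chebyshev_count (m := m) L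
  set Q := (univ.filter fun a : Fin m → Bool => (L : ℤ) ≤ |S a m|).card with hQ
  have hfar := card_farSet_add m k
  -- `12·m·Q ≤ L²·Q ≤ m·2^m`, so `12 Q ≤ 2^m`
  have h1 : (12 * m : ℤ) * Q ≤ (m : ℤ) * 2 ^ m := by
    have : ((12 * m : ℕ) : ℤ) ≤ ((L ^ 2 : ℕ) : ℤ) := by exact_mod_cast hLm
    push_cast at this
    have hQ0 : (0 : ℤ) ≤ Q := by positivity
    nlinarith
  have hm0 : (0 : ℤ) < m := by exact_mod_cast (show 0 < m by omega)
  have h2 : (12 : ℤ) * Q ≤ 2 ^ m := by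
    have : (m : ℤ) * (12 * Q) ≤ (m : ℤ) * 2 ^ m := by linarith
    exact le_of_mul_le_mul_left this hm0
  have h3 : 12 * Q ≤ 2 ^ m := by exact_mod_cast h2
  omega

end TubeMassProof

/-- **T11-4 `TubeMass` — PROVED** (`C = 6`, `m₀ = 256`). -/
theorem tubeMass : TubeMass := TubeMassProof.tubeMass_six

end Summit.QuantumAdvantage.AdviceFreeQNC0

end
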